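import Mathlib
import Summits.PneNP.PneNP.Theses.OverlapGapAlgebra
import Summits.PneNP.PneNP.Theorems.OverlapGapAlgebraSolvableImpliesStableSectionTwoWayRepairAssembly

/-!
# PneNP / OverlapGapAlgebra — crux `SolvableImpliesStableSection` (stmt-PneNP-2463):
# the TWO-WAY REPAIR block (15/·) — the crux is equivalent to its core

Support for crux `stmt-PneNP-2463` (`Summit.PneNP.PneNP.Theses.OverlapGapAlgebra.SolvableImpliesStableSection`).
With the two-way repair block the f-free part of the crux is complete on a clean region: by
`sissW_solvableImpliesStableSection_off_core`, the implication of the crux at `(k, α, η, ν)` (`k ≥ 3`,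
`α, η, ν > 0`) is a THEOREM whenever `4kα ≤ 2^k`, or `α ≥ 2^k log 2`, or `η ≥ 1`, or `ν > 2^{-k}`, or
`ν > 2^{-k}(e^{kα2^{-k}} - 1)`.  Hence the crux, as typed (all `k ≥ 3` and all `α, η, ν > 0`), is
EQUIVALENT to its restriction to the CORE
`{2^k/(4k) < α < 2^k log 2} ∩ {η < 1} ∩ {ν ≤ 2^{-k} min(1, e^{kα2^{-k}} - 1)}`:

* `sissW_solvableImpliesStableSection_iff_core` — `SolvableImpliesStableSection ↔ (core form)`.

Planner-facing: restating stmt-PneNP-2463 to the core (or to the Bresler–Huang window inside it, where it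
is summit-strength by `transfer_false_without_polyTime` + `NoStableSection`) loses nothing provable
f-free in the tree.  No new definitions; axioms `propext`, `Classical.choice`, `Quot.sound`.
-/

set_option linter.dupNamespace false -- `Summit.PneNP.PneNP.…`: summit = sub-problem (D-0017)

namespace Summit.PneNP.PneNP.Theorems

open Finset Filter
open scoped Classical

section Core

/-- **The crux is equivalent to its core.** `SolvableImpliesStableSection` holds iff it holds for
every `k ≥ 3` and `α, η, ν > 0` INSIDE the core region `2^k < 4kα`, `α < 2^k log 2`, `η < 1`,
`ν ≤ 2^{-k}`, `ν ≤ 2^{-k}(e^{kα2^{-k}} - 1)`; off the core it is the theorem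
`sissW_solvableImpliesStableSection_off_core`. -/
theorem sissW_solvableImpliesStableSection_iff_core :
    Summit.PneNP.PneNP.Theses.OverlapGapAlgebra.SolvableImpliesStableSection ↔
    (∀ k : ℕ, 3 ≤ k → ∀ α η ν : ℝ, 0 < α → 0 < η → 0 < ν →
      (2 : ℝ) ^ k < α * (4 * k) → α < (2 : ℝ) ^ k * Real.log 2 → η < 1 → ν ≤ (1 / 2 : ℝ) ^ k →
      ν ≤ (1 / 2 : ℝ) ^ k * (Real.exp (k * α * (1 / 2 : ℝ) ^ k) - 1) →
      (∃ f : List Bool → List Bool, Literature.Computability.Complexity.IsPolyTime f ∧ ∃ ε : ℝ, 0 < ε ∧ ∃ᶠ n : ℕ in Filter.atTop, ∀ m : ℕ, m = ⌊α * n⌋₊ → ε ≤ ((Finset.univ.filter fun Φ : Fin m → Fin k → Fin n × Bool => ∀ i, ∃ j, (f (Literature.Computability.Complexity.encodingCNF.encode (List.ofFn fun a => List.ofFn fun b => (((Φ a b).1 : ℕ), (Φ a b).2)))).getD (Φ i j).1 false = (Φ i j).2).card : ℝ) / Fintype.card (Fin m → Fin k → Fin n × Bool)) →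
      ∀ c : ℝ, 0 < c → ∃ᶠ n : ℕ in Filter.atTop, ∀ m : ℕ, m = ⌊α * n⌋₊ → ∃ g : (Fin m → Fin k → Fin n × Bool) → (Fin n → Bool), Real.exp (-(c * n)) * Fintype.card (Fin (k + 1) → Fin m → Fin k → Fin n × Bool) ≤ ((Finset.univ.filter fun Ψ : Fin (k + 1) → Fin m → Fin k → Fin n × Bool => let P : Fin k → ℕ → Fin m → Fin k → Fin n × Bool := fun r q a b => if (a : ℕ) * k + b < q then Ψ r.succ a b else Ψ r.castSucc a b; (∀ r : Fin k, ∀ q ≤ m * k, ((Finset.univ.filter fun i : Fin m => ∀ j, g (P r q) (P r q i j).1 ≠ (P r q i j).2).card : ℝ) ≤ ν * m) ∧ ∀ r : Fin k, ∀ q < m * k, (hammingDist (g (P r q)) (g (P r (q + 1))) : ℝ) ≤ η * n).card : ℝ)) := by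
  constructor
  · intro h k hk α η ν hα hη hν _ _ _ _ _ hsolv c hc
    exact h k hk α η ν hα hη hν hsolv c hc
  · intro hcore
    unfold Summit.PneNP.PneNP.Theses.OverlapGapAlgebra.SolvableImpliesStableSection
    intro k hk α η ν hα hη hν hsolv c hc
    by_cases h1 : (2 : ℝ) ^ k < α * (4 * k)
    · by_cases h2 : α < (2 : ℝ) ^ k * Real.log 2
      · by_cases h3 : η < 1
        · by_cases h4 : ν ≤ (1 / 2 : ℝ) ^ k
          · by_cases h5 : ν ≤ (1 / 2 : ℝ) ^ k * (Real.exp (k * α * (1 / 2 : ℝ) ^ k) - 1)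
            · exact hcore k hk α η ν hα hη hν h1 h2 h3 h4 h5 hsolv c hc
            · exact sissW_solvableImpliesStableSection_off_core k hk α η ν hα hη hν
                (Or.inr (Or.inr (Or.inr (Or.inr (not_le.1 h5))))) hsolv c hc
          · exact sissW_solvableImpliesStableSection_off_core k hk α η ν hα hη hν
              (Or.inr (Or.inr (Or.inr (Or.inl (not_le.1 h4))))) hsolv c hc
        · exact sissW_solvableImpliesStableSection_off_core k hk α η ν hα hη hν
            (Or.inr (Or.inr (Or.inl (not_lt.1 h3)))) hsolv c hc
      · exact sissW_solvableImpliesStableSection_off_core k hk α η ν hα hη hν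
          (Or.inr (Or.inl (not_lt.1 h2))) hsolv c hc
    · exact sissW_solvableImpliesStableSection_off_core k hk α η ν hα hη hν
        (Or.inl (not_lt.1 h1)) hsolv c hc

end Core

end Summit.PneNP.PneNP.Theorems
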